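/-
Copyright: the b2b-balaban T⁴-continuum CRUX team, row NE7b owner lineage `t4-ne7b-p1` (gen 114). Project licence.
-/
import Summits.QuantumFields.BalabanUV.T4Continuum.Spine.NE7b.AugmentedSupEquivalence
import Summits.QuantumFields.BalabanUV.T4Continuum.Spine.NE7b.LocalNemytskiiSup
import Summits.QuantumFields.BalabanUV.T4Continuum.Spine.NE7b.SupInteractingChart

/-!
# THE SMALL-FIELD BACKGROUND CONFIGURATION OF THE PERTURBED GAUSSIAN SKELETON ON `ℤ^d`, IN THE SUP NORM: for `d ≥ 3`, `a > 0`,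
# EVERY block side `n + 1`, and every sitewise term `u = v′` with `u 0 = 0`, `|u′| ≤ λ`, `u′` `L`-Lipschitz and `2λ ≤ c < N⁻¹`
# (`N ≥ N_∞`, the sup-currency chart constant of the free skeleton): for every radius `r` and every coarse field
# `‖w‖_∞ ≤ (N⁻¹ − c)·r` there is EXACTLY ONE fine field `φ = σ(w)` with `‖φ‖_∞ ≤ r`, `Q′φ = w` and `Aφ + u∘φ` BLOCK-CONSTANT
# (the constrained Euler–Lagrange equation of `½⟨φ, (Δ^η + aQ′*Q′)φ⟩ + Σ_x v(φ(x))`); `σ` is `(N⁻¹ − c)⁻¹`-Lipschitz and `C¹` in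
# `w` with `‖Dσ(w)‖ ≤ (N⁻¹ − c)⁻¹`, `Q′ ∘ Dσ(w) = 1`
# (row NE7b, node U5c; leaf-06's (57) `…AugmentedSupEquivalence` (the chart) × the owner's (58) `…LocalNemytskiiSup` (the Nemytskii letter
# and HSCR∕HSBD's branch) BY NAME; [folklore])

Cell `pub-balaban`, sub-cell `t4`, spine estimate NE7b (`T4WeightBudget.RelWeightBound`; the cell's OWN estimate — NOT PRINTED
in [Bałaban 1983–89], NOT PROVED).  Crux-route work under `Spine/NE7b/` by the row OWNER (`t4-ne7b-p1` gen 114) under FREEZE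
(0)'s crux-prover clause (FILING-CLAIM C-ne7bp1-g114-6); NOTHING of Bałaban's is named as a Lean object, valued or asserted; no
`T4Continuum/Support` leaf typed; no `def`, no notation; zero `sorry`.  Imports (BY NAME): leaf-06 g160's (57)
`…AugmentedSupEquivalence` (`exists_aug_equiv_sup`: the operators `Q′`, `A`, `P = 1 − Q′*Q′` on `ℓ^∞(ℤ^d)`, the reduced `R = P∘A` into
`ker Q′`, the chart `T h = (Q′h, Rh)` with `‖T⁻¹y‖ ≤ N_∞‖y‖`; `blockAvg_fibreProj`) and the owner's (58) `…LocalNemytskiiSup`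
(`exists_smallField_branch_deriv`, `abs_apply_le_norm`); through them (46)–(52), (56), HSCR, HSBD; (v1.1) the owner's (61)
`…SupInteractingChart` v1.1 (`exists_fluctuation_covariance_at_background`; HSBDM behind it).

WHY (located).  (58) typed the background configuration for ANY chart `T : ℓ^∞ ≃L F × K`; (57) typed THE chart of the free skeleton
on `ℤ^d` in the sup currency.  This file is the one-screen junction: the projection `P` is turned into the transversal map
`ℓ^∞ →L ker Q′` of norm `≤ 2` (so `c = 2λ`), (58) is applied at `ι := ℤ^d`, and the conclusion `R φ + P_K(u∘φ) = 0` in `ker Q′` is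
read back in `ℓ^∞` as «`Aφ + u∘φ` equals its own block average», i.e. lies in the range of `Q′*` — the Lagrange-multiplier form of the
constrained critical-point equation.  The smallness condition is `2·sup|v″| < N⁻¹` with `N` ANY `ℝ≥0` above (57)'s displayed
`N_∞ = C_∞ + A_G K_d(δ_u∕4)(1 + C_∞)`; the radius `r` is free.

WHAT IS PROVED ([folklore]; `ℓ^∞ := lp (fun _ : X d => ℝ) ∞`):
* §1 `exists_clm_toKer` — an operator `P` with `Q′ ∘ P = 0` factors through `ker Q′` as `P_K : ℓ^∞ →L ker Q′` with `↑(P_K f) = P f` and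
  `‖P_K f‖ ≤ 2‖f‖` when `P` has the displayed action `f − Q′*Q′f`; `blockConst_of_fibreProj_eq_zero` (`P f = 0` ⟹ `f(p) = (Q′f)(blk p)`).
* §2 **`exists_background`** — the statement of the title: `∃ Q′ A P` (actions displayed) `∃ σ : ℓ^∞ → ℓ^∞`, `σ 0 = 0`; on
  `‖w‖ ≤ (N⁻¹ − c)r`: `‖σ w‖ ≤ r`, `Q′(σ w) = w`, and for every site `p`,
  `(A(σ w))(p) + u((σ w)(p)) = (n+1)^{−d} Σ_{p′ ∈ B(blk p)} ((A(σ w))(p′) + u((σ w)(p′)))`; `σ` `(N⁻¹ − c)⁻¹`-Lipschitz there; uniqueness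
  (every `‖φ‖ ≤ r` with `P(Aφ + u∘φ) = 0` is `σ(Q′φ)`); and on `‖w‖ < (N⁻¹ − c)r`: `σ` differentiable, `‖Dσ(w)‖ ≤ (N⁻¹ − c)⁻¹`,
  `Q′ ∘ Dσ(w) = 1`.
* §3 toy.
* §4 (v1.1, APPEND) `chart_inl_letters` (any normed currency: `Q(A⁻¹(v,0)) = v`, `‖A⁻¹∘inl‖ ≤ N₁`, `Q∘(A⁻¹∘inl) = 1` for a chart
  `A h = (Q h, S h)`, `S` a bare function) and **`exists_background_covariance`** — §2's data and letters WITH, on the interior ball,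
  the background response `D = Dσ(w)` (`HasFDerivAt σ D w`, `‖D‖ ≤ (N⁻¹ − c)⁻¹`, `Q′ ∘ D = 1`) and THE FLUCTUATION COVARIANCE OF THE
  PERTURBED SKELETON AT THE BACKGROUND as an operator `C̃(w) : ℓ^∞ →L ℓ^∞`: `Q′ ∘ C̃(w) = 0`, `P(A(C̃(w)g) + (u′∘σ w)·C̃(w)g) = P g`
  (the fibre equation of the linearised perturbed action; `C̃(w)g` its only solution in `ker Q′`), **`‖C̃(w)g‖ ≤ 2(N⁻¹ − c)⁻¹‖g‖`**
  (`≤ (N⁻¹ − c)⁻¹‖g‖` on `ker Q′`), and the modulus **`‖C̃(w)g − C̃(w′)g‖ ≤ (N⁻¹ − c)⁻³·4L·‖w − w′‖·‖g‖`** — (61) §8 at `ι := ℤ^d`,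
  `K := ker Q′`, composed with §1's `P_K`.

HONEST (what this is NOT).  Scalar `ℤ^d` skeleton with a sitewise perturbation whose `v″`, `v‴` are GLOBALLY bounded; constants
existential and, in the pure-sup currency, USELESS BY VALUE at small sides (leaf-03's TCS2: the sup letter is false at `M = 2`; the mixed
currency of record, W-ne7bp1-g113-3, would enter through the same (58) with its own chart); nothing of the covariant `H_k`, `G_k(U)`
((A3), NC-NE7b-α UNRULED); anything of Bałaban's.  BY-NAME EFFECT ON THE WALL: NONE.  NE7b NOT PRINTED ∕ NOT PROVED; spine PROVED 0∕9;
rung (B)+1 on a FINITE torus — NOT infinite volume, NOT the mass gap, NOT Clay.  HONEST DEPENDENCY: continuum YM on T⁴ ⇐ BetaPertH ∧ nine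
spine estimates (0∕9 proved); BetaPertH ⇐ (D1) ∧ (D4) ∧ CAP+tail; G-an2-4 gates asym, D1 and NE2∕3∕4.
-/

set_option autoImplicit false

noncomputable section

namespace Summit.QuantumFields.BalabanUV.T4Continuum.NE7b.SupSmallFieldBackground

open Set Metric
open scoped ENNReal NNReal
open Literature.MathematicalPhysics.QuantumFieldTheory.Balaban1983to89
open B4Sect5Proof (latticeConst latticeConst_nonneg)
open B6QGQLower276 (X blk B AX)
open B6QGQDecay237 (deltaU deltaU_pos)
open B5Hk103ScalarZd (nbhd deltaH deltaH_pos)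
open Summit.QuantumFields.BalabanUV.Beta.D1BFx.BlockColumnSupNorm (cHs cHs_nonneg)
open Summit.QuantumFields.BalabanUV.Beta.D1BFx.PointColumnSplit (cKL cG0 cSplit)
open Summit.QuantumFields.BalabanUV.Beta.D1BFx.PointColumnDecay (cFar)
open FibreInverseSupNorm (abs_blockAvg_le)
open AugmentedSupEquivalence (exists_aug_equiv_sup blockAvg_fibreProj)
open LocalNemytskiiSup (exists_smallField_branch_deriv)
open SupInteractingChart (exists_fluctuation_covariance_at_background)

variable {d : ℕ}

/-! ## §1. The fibre projection as a map into `ker Q′`; block-constancy from `P f = 0` -/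

/-- **`P` AS A MAP INTO `ker Q′` OF NORM `≤ 2`**: if `Q′ ∘ P = 0` and `P` acts as `f − Q′*Q′f`, then `P` factors as
`P_K : ℓ^∞ →L ker Q′` with `↑(P_K f) = P f` and `‖P_K‖ ≤ 2`. [folklore] -/
theorem exists_clm_toKer (n : ℕ) (Dop Pop : lp (fun _ : X d => ℝ) ∞ →L[ℝ] lp (fun _ : X d => ℝ) ∞)
    (hDP : ∀ f : lp (fun _ : X d => ℝ) ∞, Dop (Pop f) = 0)
    (hP : ∀ (f : lp (fun _ : X d => ℝ) ∞) (p : X d),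
      Pop f p = f p - (((n : ℝ) + 1) ^ d)⁻¹ * ∑ p' ∈ B n (blk n p), f p') :
    ∃ PK : lp (fun _ : X d => ℝ) ∞ →L[ℝ] Dop.ker,
      (∀ f : lp (fun _ : X d => ℝ) ∞, (PK f : lp (fun _ : X d => ℝ) ∞) = Pop f) ∧ ‖PK‖ ≤ 2 := by
  have hmem : ∀ f : lp (fun _ : X d => ℝ) ∞, Pop f ∈ Dop.ker := fun f => LinearMap.mem_ker.mpr (hDP f)
  refine ⟨Pop.codRestrict Dop.ker hmem, fun f => rfl, ?_⟩
  refine ContinuousLinearMap.opNorm_le_bound _ zero_le_two fun f => ?_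
  have hn : ‖Pop.codRestrict Dop.ker hmem f‖ = ‖Pop f‖ := rfl
  rw [hn]
  refine lp.norm_le_of_forall_le (mul_nonneg zero_le_two (norm_nonneg f)) fun p => ?_
  rw [Real.norm_eq_abs, hP]
  calc |f p - (((n : ℝ) + 1) ^ d)⁻¹ * ∑ p' ∈ B n (blk n p), f p'|
      ≤ |f p| + |(((n : ℝ) + 1) ^ d)⁻¹ * ∑ p' ∈ B n (blk n p), f p'| := abs_sub _ _
    _ ≤ ‖f‖ + ‖f‖ := add_le_add (LocalNemytskiiSup.abs_apply_le_norm f p)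
        (abs_blockAvg_le n (fun q => LocalNemytskiiSup.abs_apply_le_norm f q) (blk n p))
    _ = 2 * ‖f‖ := by ring

/-- **`P f = 0` MEANS `f` EQUALS ITS BLOCK AVERAGE**: `f(p) = (n+1)^{−d} Σ_{p′ ∈ B(blk p)} f(p′)` for every site. [folklore] -/
theorem blockConst_of_fibreProj_eq_zero (n : ℕ) (Pop : lp (fun _ : X d => ℝ) ∞ →L[ℝ] lp (fun _ : X d => ℝ) ∞)
    (hP : ∀ (f : lp (fun _ : X d => ℝ) ∞) (p : X d),
      Pop f p = f p - (((n : ℝ) + 1) ^ d)⁻¹ * ∑ p' ∈ B n (blk n p), f p')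
    {f : lp (fun _ : X d => ℝ) ∞} (hf : Pop f = 0) (p : X d) :
    f p = (((n : ℝ) + 1) ^ d)⁻¹ * ∑ p' ∈ B n (blk n p), f p' := by
  have e : Pop f p = 0 := by rw [hf, lp.coeFn_zero, Pi.zero_apply]
  rw [hP] at e
  exact sub_eq_zero.mp e

/-! ## §2. The background configuration of the perturbed Gaussian skeleton -/

/-- **THE SMALL-FIELD BACKGROUND CONFIGURATION OF THE PERTURBED GAUSSIAN SKELETON ON `ℤ^d`, IN THE SUP NORM** (`d ≥ 3`, `a > 0`,
every side `n + 1`).  Data: a sitewise term `u` (`= v′`) with `u 0 = 0`, derivative `u′` everywhere, `|u′| ≤ λ`, `u′` `L`-Lipschitz;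
constants `N ≥ N_∞` ((57)'s displayed chart constant), `2λ ≤ c < N⁻¹`; a radius `r ≥ 0`.  Conclusion: operators `Q′`, `A`, `P` with
their displayed actions and a map `σ : ℓ^∞ → ℓ^∞`, `σ 0 = 0`, such that on `‖w‖ ≤ (N⁻¹ − c)·r`: `‖σ w‖ ≤ r`, `Q′(σ w) = w`, and
`A(σ w) + u∘(σ w)` equals its own block average sitewise (the constrained Euler–Lagrange equation); `σ` is `(N⁻¹ − c)⁻¹`-Lipschitz
there; every `‖φ‖ ≤ r` with `P(Aφ + u∘φ) = 0` is `σ(Q′φ)`; and on `‖w‖ < (N⁻¹ − c)·r`, `σ` is differentiable with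
`‖Dσ(w)‖ ≤ (N⁻¹ − c)⁻¹` and `Q′ ∘ Dσ(w) = 1`. [folklore] -/
theorem exists_background (hd : 3 ≤ d) (n : ℕ) {a : ℝ} (ha : 0 < a)
    {u u' : ℝ → ℝ} (hu : ∀ t, HasDerivAt u (u' t) t) (hu0 : u 0 = 0) {lam c N : ℝ≥0} (hlam : ∀ t, |u' t| ≤ lam)
    {L : ℝ} (hL0 : 0 ≤ L) (hL : ∀ s t, |u' s - u' t| ≤ L * |s - t|)
    (hN : cHs d a * latticeConst d (deltaH d a)
        + ((cG0 d * cKL d (d - 2) + cSplit d a) * Real.exp (2 * deltaU d a)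
            + cFar d a * Real.exp (4 * deltaU d a) / deltaU d a ^ 2) * latticeConst d (deltaU d a / 4)
          * (1 + cHs d a * latticeConst d (deltaH d a)) ≤ (N : ℝ))
    (hc : 2 * lam ≤ c) (hcN : c < N⁻¹) {r : ℝ} (hr : 0 ≤ r) :
    ∃ (Dop Aop Pop : lp (fun _ : X d => ℝ) ∞ →L[ℝ] lp (fun _ : X d => ℝ) ∞)
      (σ : lp (fun _ : X d => ℝ) ∞ → lp (fun _ : X d => ℝ) ∞),
      (∀ (f : lp (fun _ : X d => ℝ) ∞) (y : X d), Dop f y = (((n : ℝ) + 1) ^ d)⁻¹ * ∑ p ∈ B n y, f p) ∧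
      (∀ (f : lp (fun _ : X d => ℝ) ∞) (p : X d), Aop f p = ∑ r ∈ nbhd n p, AX n a p r * f r) ∧
      (∀ (f : lp (fun _ : X d => ℝ) ∞) (p : X d), Pop f p = f p - (((n : ℝ) + 1) ^ d)⁻¹ * ∑ p' ∈ B n (blk n p), f p') ∧
      σ 0 = 0 ∧
      (∀ w ∈ closedBall (0 : lp (fun _ : X d => ℝ) ∞) (((N : ℝ)⁻¹ - c) * r),
        σ w ∈ closedBall 0 r ∧ Dop (σ w) = w ∧
          ∀ p : X d, Aop (σ w) p + u (σ w p)
            = (((n : ℝ) + 1) ^ d)⁻¹ * ∑ p' ∈ B n (blk n p), (Aop (σ w) p' + u (σ w p'))) ∧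
      LipschitzOnWith (N⁻¹ - c)⁻¹ σ (closedBall (0 : lp (fun _ : X d => ℝ) ∞) (((N : ℝ)⁻¹ - c) * r)) ∧
      (∀ φ ∈ closedBall (0 : lp (fun _ : X d => ℝ) ∞) r,
        (∀ p : X d, Aop φ p + u (φ p) = (((n : ℝ) + 1) ^ d)⁻¹ * ∑ p' ∈ B n (blk n p), (Aop φ p' + u (φ p'))) →
          σ (Dop φ) = φ) ∧
      (∀ w ∈ ball (0 : lp (fun _ : X d => ℝ) ∞) (((N : ℝ)⁻¹ - c) * r),
        DifferentiableAt ℝ σ w ∧ ‖fderiv ℝ σ w‖ ≤ ((N : ℝ)⁻¹ - c)⁻¹ ∧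
          Dop.comp (fderiv ℝ σ w) = ContinuousLinearMap.id ℝ (lp (fun _ : X d => ℝ) ∞)) := by
  haveI : Nonempty (X d) := ⟨fun _ => 0⟩
  obtain ⟨Dop, Aop, Pop, hD, hA, hP, -, -, Rop, hRapp, T, hT, -, hTN⟩ := exists_aug_equiv_sup hd n ha
  obtain ⟨PK, hPK, hPKnorm⟩ := exists_clm_toKer n Dop Pop (blockAvg_fibreProj hD hP) hP
  have hTN' : ∀ y : lp (fun _ : X d => ℝ) ∞ × Dop.ker, ‖T.symm y‖ ≤ N * ‖y‖ := fun y =>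
    (hTN y).trans (mul_le_mul_of_nonneg_right hN (norm_nonneg y))
  have hPK2 : ‖PK‖ ≤ ((2 : ℝ≥0) : ℝ) := by rw [NNReal.coe_ofNat]; exact hPKnorm
  obtain ⟨Nu, σ, hNu, hσ0, hσ, hlip, huniq, hderiv⟩ :=
    exists_smallField_branch_deriv (ι := X d) Dop Rop PK T hT hTN' hPK2 hc hcN hu hu0 hlam hL0 hL hr
  -- the equation `R φ + P_K (u∘φ) = 0` in `ker Q′`, read in `ℓ^∞`: `P (Aφ + u∘φ) = 0`
  have hNu_eq : ∀ φ : lp (fun _ : X d => ℝ) ∞, ∀ p : X d, (Aop φ + Nu φ) p = Aop φ p + u (φ p) := fun φ p => by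
    rw [lp.coeFn_add, Pi.add_apply, hNu]
  have hEL_iff : ∀ φ : lp (fun _ : X d => ℝ) ∞, Rop φ + PK (Nu φ) = 0 ↔ Pop (Aop φ + Nu φ) = 0 := fun φ => by
    constructor
    · intro h
      have e := congrArg Subtype.val h
      rw [Submodule.coe_add, hRapp, hPK, ZeroMemClass.coe_zero, ← map_add] at e
      exact e
    · intro h
      apply Subtype.ext
      rw [Submodule.coe_add, hRapp, hPK, ZeroMemClass.coe_zero, ← map_add]
      exact h
  have hsd : (0 : ℝ) < ((n : ℝ) + 1) ^ d := by positivity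
  refine ⟨Dop, Aop, Pop, σ, hD, hA, hP, hσ0, fun w hw => ?_, hlip, fun φ hφ hEL => ?_, hderiv⟩
  · obtain ⟨h1, h2, h3⟩ := hσ w hw
    refine ⟨h1, h2, fun p => ?_⟩
    have h4 : Pop (Aop (σ w) + Nu (σ w)) = 0 := (hEL_iff (σ w)).mp h3
    have h5 := blockConst_of_fibreProj_eq_zero n Pop hP h4 p
    rw [hNu_eq] at h5
    rw [h5]
    exact congrArg _ (Finset.sum_congr rfl fun p' _ => hNu_eq (σ w) p')
  · refine huniq φ hφ ((hEL_iff φ).mpr (lp.ext (funext fun p => ?_)))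
    rw [hP, lp.coeFn_zero, Pi.zero_apply, hNu_eq, Finset.sum_congr rfl fun p' _ => hNu_eq φ p', hEL p, sub_self]

/-! ## §3. Toy -/

/-- Toy: the smallness bookkeeping — with `λ = 1∕10` and `N = 2`, `c := 2λ = 1∕5 < N⁻¹ = 1∕2`, and the radius factor is
`N⁻¹ − c = 3∕10`. -/
example : (2 : ℝ) * (1 / 10) < (2 : ℝ)⁻¹ ∧ (2 : ℝ)⁻¹ - 2 * (1 / 10) = 3 / 10 := by norm_num

/-! ## §4. (v1.1, APPEND) The fluctuation covariance of the perturbed skeleton at the background, as an operator on `ℓ^∞(ℤ^d)` -/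

section ChartInl

variable {E F K : Type*} [NormedAddCommGroup E] [NormedSpace ℝ E] [NormedAddCommGroup F] [NormedSpace ℝ F]
  [NormedAddCommGroup K] [NormedSpace ℝ K]

/-- The background-response column of a chart's inverse, any normed currency: for `A h = (Q h, S h)` with `‖A⁻¹ z‖ ≤ N₁‖z‖`,
`Q(A⁻¹(v, 0)) = v`, `‖A⁻¹ ∘ inl‖ ≤ N₁`, `Q ∘ (A⁻¹ ∘ inl) = 1` (`S` a bare function: no operator algebra in the fibre). [folklore] -/
theorem chart_inl_letters (A : E ≃L[ℝ] F × K) (Q : E →L[ℝ] F) (S : E → K) (hA : ∀ h, A h = (Q h, S h)) {N₁ : ℝ}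
    (hN0 : 0 ≤ N₁) (hN : ∀ z : F × K, ‖A.symm z‖ ≤ N₁ * ‖z‖) :
    (∀ v : F, Q (A.symm (v, 0)) = v) ∧
      ‖(A.symm : F × K →L[ℝ] E).comp (ContinuousLinearMap.inl ℝ F K)‖ ≤ N₁ ∧
      Q.comp ((A.symm : F × K →L[ℝ] E).comp (ContinuousLinearMap.inl ℝ F K)) = ContinuousLinearMap.id ℝ F := by
  have h1 : ∀ v : F, Q (A.symm (v, 0)) = v := fun v => by
    have e : A (A.symm (v, 0)) = (v, 0) := A.apply_symm_apply (v, 0)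
    rw [hA] at e
    exact (Prod.ext_iff.1 e).1
  refine ⟨h1, ContinuousLinearMap.opNorm_le_bound _ hN0 fun v => ?_, ContinuousLinearMap.ext fun v => ?_⟩
  · have e := hN (v, 0)
    rw [Prod.norm_mk, norm_zero, max_eq_left (norm_nonneg v)] at e
    exact e
  · exact h1 v

end ChartInl

/-- **THE FLUCTUATION COVARIANCE OF THE PERTURBED GAUSSIAN SKELETON AT THE BACKGROUND, AS AN OPERATOR ON `ℓ^∞(ℤ^d)`** (`d ≥ 3`,
`a > 0`, every side `n + 1`; §2's data and smallness `2λ ≤ c < N⁻¹`, `N ≥ N_∞`).  With §2's operators `Q′`, `A`, `P` and the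
multiplication family `N′φ h = (u′∘φ)·h`: a background map `σ` with §2's letters (`σ 0 = 0`; on `‖w‖ ≤ (N⁻¹ − c)r`: `‖σ w‖ ≤ r`,
`Q′(σ w) = w`, `A(σ w) + u∘σ w` block-constant; Lipschitz), and on the interior `‖w‖ < (N⁻¹ − c)r`: the background response `Dσ(w)`
(`HasFDerivAt`, `‖Dσ(w)‖ ≤ (N⁻¹ − c)⁻¹`, `Q′ ∘ Dσ(w) = 1`) AND the covariance `C̃(w) : ℓ^∞ →L ℓ^∞`: `Q′(C̃(w)g) = 0`,
**`P(A(C̃(w)g) + N′(σ w)(C̃(w)g)) = P g`** (the fibre equation of the linearised perturbed action at the background — `C̃(w)g` is its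
ONLY solution in `ker Q′`), `‖C̃(w)g‖ ≤ 2(N⁻¹ − c)⁻¹‖g‖` (`‖·‖ ≤ (N⁻¹ − c)⁻¹‖g‖` for `g ∈ ker Q′`), and the background-dependence
modulus **`‖C̃(w)g − C̃(w′)g‖ ≤ (N⁻¹ − c)⁻³·(4L)·‖w − w′‖·‖g‖` — (61) §8 `exists_fluctuation_covariance_at_background` at `ι := ℤ^d`,
`K := ker Q′`, `P_K` of §1 (`C_P = 2`), composed with `P_K`. [folklore] -/
theorem exists_background_covariance (hd : 3 ≤ d) (n : ℕ) {a : ℝ} (ha : 0 < a)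
    {u u' : ℝ → ℝ} (hu : ∀ t, HasDerivAt u (u' t) t) (hu0 : u 0 = 0) {lam c N : ℝ≥0} (hlam : ∀ t, |u' t| ≤ lam)
    {L : ℝ} (hL0 : 0 ≤ L) (hL : ∀ s t, |u' s - u' t| ≤ L * |s - t|)
    (hN : cHs d a * latticeConst d (deltaH d a)
        + ((cG0 d * cKL d (d - 2) + cSplit d a) * Real.exp (2 * deltaU d a)
            + cFar d a * Real.exp (4 * deltaU d a) / deltaU d a ^ 2) * latticeConst d (deltaU d a / 4)
          * (1 + cHs d a * latticeConst d (deltaH d a)) ≤ (N : ℝ))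
    (hc : 2 * lam ≤ c) (hcN : c < N⁻¹) {r : ℝ} (hr : 0 ≤ r) :
    ∃ (Dop Aop Pop : lp (fun _ : X d => ℝ) ∞ →L[ℝ] lp (fun _ : X d => ℝ) ∞)
      (N' : lp (fun _ : X d => ℝ) ∞ → (lp (fun _ : X d => ℝ) ∞ →L[ℝ] lp (fun _ : X d => ℝ) ∞))
      (σ : lp (fun _ : X d => ℝ) ∞ → lp (fun _ : X d => ℝ) ∞)
      (Cf : lp (fun _ : X d => ℝ) ∞ → (lp (fun _ : X d => ℝ) ∞ →L[ℝ] lp (fun _ : X d => ℝ) ∞)),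
      (∀ (f : lp (fun _ : X d => ℝ) ∞) (y : X d), Dop f y = (((n : ℝ) + 1) ^ d)⁻¹ * ∑ p ∈ B n y, f p) ∧
      (∀ (f : lp (fun _ : X d => ℝ) ∞) (p : X d), Aop f p = ∑ r ∈ nbhd n p, AX n a p r * f r) ∧
      (∀ (f : lp (fun _ : X d => ℝ) ∞) (p : X d), Pop f p = f p - (((n : ℝ) + 1) ^ d)⁻¹ * ∑ p' ∈ B n (blk n p), f p') ∧
      (∀ (φ h : lp (fun _ : X d => ℝ) ∞) (p : X d), N' φ h p = u' (φ p) * h p) ∧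
      σ 0 = 0 ∧
      (∀ w ∈ closedBall (0 : lp (fun _ : X d => ℝ) ∞) (((N : ℝ)⁻¹ - c) * r),
        σ w ∈ closedBall 0 r ∧ Dop (σ w) = w ∧
          ∀ p : X d, Aop (σ w) p + u (σ w p)
            = (((n : ℝ) + 1) ^ d)⁻¹ * ∑ p' ∈ B n (blk n p), (Aop (σ w) p' + u (σ w p'))) ∧
      LipschitzOnWith (N⁻¹ - c)⁻¹ σ (closedBall (0 : lp (fun _ : X d => ℝ) ∞) (((N : ℝ)⁻¹ - c) * r)) ∧
      (∀ w ∈ ball (0 : lp (fun _ : X d => ℝ) ∞) (((N : ℝ)⁻¹ - c) * r),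
        (∃ D : lp (fun _ : X d => ℝ) ∞ →L[ℝ] lp (fun _ : X d => ℝ) ∞,
          HasFDerivAt σ D w ∧ ‖D‖ ≤ ((N : ℝ)⁻¹ - c)⁻¹ ∧ Dop.comp D = ContinuousLinearMap.id ℝ (lp (fun _ : X d => ℝ) ∞)) ∧
        (∀ g : lp (fun _ : X d => ℝ) ∞, Dop (Cf w g) = 0) ∧
        (∀ g : lp (fun _ : X d => ℝ) ∞, Pop (Aop (Cf w g) + N' (σ w) (Cf w g)) = Pop g) ∧
        (∀ g h : lp (fun _ : X d => ℝ) ∞, Dop h = 0 → Pop (Aop h + N' (σ w) h) = Pop g → h = Cf w g) ∧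
        (∀ g : lp (fun _ : X d => ℝ) ∞, ‖Cf w g‖ ≤ 2 * ((N : ℝ)⁻¹ - c)⁻¹ * ‖g‖) ∧
        (∀ g : lp (fun _ : X d => ℝ) ∞, Dop g = 0 → ‖Cf w g‖ ≤ ((N : ℝ)⁻¹ - c)⁻¹ * ‖g‖)) ∧
      (∀ w ∈ ball (0 : lp (fun _ : X d => ℝ) ∞) (((N : ℝ)⁻¹ - c) * r),
        ∀ w' ∈ ball (0 : lp (fun _ : X d => ℝ) ∞) (((N : ℝ)⁻¹ - c) * r), ∀ g : lp (fun _ : X d => ℝ) ∞,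
          ‖Cf w g - Cf w' g‖ ≤ ((N : ℝ)⁻¹ - c)⁻¹ ^ 3 * (4 * L) * ‖w - w'‖ * ‖g‖) := by
  haveI : Nonempty (X d) := ⟨fun _ => 0⟩
  obtain ⟨Dop, Aop, Pop, hD, hA, hP, -, -, Rop, hRapp, T, hT, -, hTN⟩ := exists_aug_equiv_sup hd n ha
  obtain ⟨PK, hPK, hPKnorm⟩ := exists_clm_toKer n Dop Pop (blockAvg_fibreProj hD hP) hP
  have hTN' : ∀ y : lp (fun _ : X d => ℝ) ∞ × Dop.ker, ‖T.symm y‖ ≤ N * ‖y‖ := fun y =>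
    (hTN y).trans (mul_le_mul_of_nonneg_right hN (norm_nonneg y))
  have hPK2 : ‖PK‖ ≤ ((2 : ℝ≥0) : ℝ) := by rw [NNReal.coe_ofNat]; exact hPKnorm
  obtain ⟨Nu, N', σ, C, hNu, hN'app, -, -, hσ0, hσ, hlip, -, hcov, hmod⟩ :=
    exists_fluctuation_covariance_at_background (ι := X d) Dop Rop PK T hT hTN' hPK2 hc hcN hu hu0 hlam hL0 hL hr
  have hK0 : (0 : ℝ) ≤ ((N : ℝ)⁻¹ - c)⁻¹ := by
    have h := NNReal.coe_lt_coe.2 hcN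
    rw [NNReal.coe_inv] at h
    exact inv_nonneg.2 (sub_nonneg.2 h.le)
  -- `P_K g` has norm `‖P g‖ ≤ 2‖g‖`, and `= ‖g‖` on `ker Q′`
  have hPKb : ∀ g : lp (fun _ : X d => ℝ) ∞, ‖PK g‖ ≤ 2 * ‖g‖ := fun g =>
    (PK.le_opNorm g).trans (mul_le_mul_of_nonneg_right hPKnorm (norm_nonneg g))
  have hPKk : ∀ g : lp (fun _ : X d => ℝ) ∞, Dop g = 0 → ‖PK g‖ = ‖g‖ := fun g hg => by
    rw [Submodule.coe_norm, hPK, AugmentedSupEquivalence.fibreProj_of_mem_ker hD hP g hg]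
  -- the fibre equation in `ker Q′` read in `ℓ^∞`
  have hNu_eq : ∀ φ : lp (fun _ : X d => ℝ) ∞, ∀ p : X d, (Aop φ + Nu φ) p = Aop φ p + u (φ p) := fun φ p => by
    rw [lp.coeFn_add, Pi.add_apply, hNu]
  have hfib_iff : ∀ (x h : lp (fun _ : X d => ℝ) ∞) (κ : Dop.ker),
      Rop h + PK (N' x h) = κ ↔ Pop (Aop h + N' x h) = (κ : lp (fun _ : X d => ℝ) ∞) := fun x h κ => by
    constructor
    · intro e
      have e' := congrArg Subtype.val e
      rw [Submodule.coe_add, hRapp, hPK, ← map_add] at e'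
      exact e'
    · intro e
      apply Subtype.ext
      rw [Submodule.coe_add, hRapp, hPK, ← map_add]
      exact e
  -- the covariance composed with `P_K`, sealed behind its action
  obtain ⟨Cf, hCf⟩ : ∃ Cf : lp (fun _ : X d => ℝ) ∞ → (lp (fun _ : X d => ℝ) ∞ →L[ℝ] lp (fun _ : X d => ℝ) ∞),
      ∀ (w g : lp (fun _ : X d => ℝ) ∞), Cf w g = C w (PK g) := ⟨fun w => (C w).comp PK, fun w g => rfl⟩
  refine ⟨Dop, Aop, Pop, N', σ, Cf, hD, hA, hP, hN'app, hσ0, fun w hw => ?_, hlip, fun w hw => ?_,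
    fun w hw w' hw' g => ?_⟩
  · -- §2's closed-ball letters, the equation read sitewise
    obtain ⟨h1, h2, h3⟩ := hσ w hw
    refine ⟨h1, h2, fun p => ?_⟩
    have h4 : Pop (Aop (σ w) + Nu (σ w)) = 0 := by
      have e := congrArg Subtype.val h3
      rw [Submodule.coe_add, hRapp, hPK, ZeroMemClass.coe_zero, ← map_add] at e
      exact e
    have h5 := blockConst_of_fibreProj_eq_zero n Pop hP h4 p
    rw [hNu_eq] at h5
    rw [h5]
    exact congrArg _ (Finset.sum_congr rfl fun p' _ => hNu_eq (σ w) p')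
  · obtain ⟨hQC, hfib, huniq, hCb, -, A, hAeq, hAinv, hAd, -⟩ := hcov w hw
    obtain ⟨-, hn, hid⟩ := chart_inl_letters A Dop (fun h => Rop h + PK (N' (σ w) h)) hAeq hK0 hAinv
    refine ⟨⟨_, hAd, hn, hid⟩, fun g => ?_, fun g => ?_, fun g h hh he => ?_, fun g => ?_, fun g hg => ?_⟩
    · rw [hCf]; exact hQC (PK g)
    · rw [hCf]
      have e := (hfib_iff (σ w) (C w (PK g)) (PK g)).1 (hfib (PK g))
      rw [hPK] at e
      exact e
    · rw [hCf]
      exact huniq h (PK g) hh ((hfib_iff (σ w) h (PK g)).2 (by rw [hPK]; exact he))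
    · rw [hCf]
      exact (hCb (PK g)).trans ((mul_le_mul_of_nonneg_left (hPKb g) hK0).trans_eq (by ring))
    · rw [hCf]
      exact (hCb (PK g)).trans_eq (by rw [hPKk g hg])
  · rw [hCf, hCf]
    refine (hmod w hw w' hw' (PK g)).trans ?_
    have h0 : (0 : ℝ) ≤ ((N : ℝ)⁻¹ - c)⁻¹ ^ 3 * (((2 : ℝ≥0) : ℝ) * L) * ‖w - w'‖ :=
      mul_nonneg (mul_nonneg (pow_nonneg hK0 3) (mul_nonneg (by norm_num) hL0)) (norm_nonneg _)
    refine (mul_le_mul_of_nonneg_left (hPKb g) h0).trans_eq ?_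
    rw [NNReal.coe_ofNat]; ring

/-- Toy for §4: the two constants' shapes — `N = 2`, `c = 1∕5`: `2(N⁻¹ − c)⁻¹ = 20∕3` and, with `L = 3`, `(N⁻¹ − c)⁻³·(4L) = 4000∕9`. -/
example : 2 * ((2 : ℝ)⁻¹ - 1 / 5)⁻¹ = 20 / 3 ∧ ((2 : ℝ)⁻¹ - 1 / 5)⁻¹ ^ 3 * (4 * 3) = 4000 / 9 := by norm_num


end Summit.QuantumFields.BalabanUV.T4Continuum.NE7b.SupSmallFieldBackground

end
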